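import Summits.Ventures.HodgeRepro2.T5SU11SphericalAsymptotic
import Summits.Ventures.HodgeRepro2.T5BergmanIntegrableSharp

/-!
# `L^p`-integrability of the spherical functions of `SU(1,1)`: `φ_λ ∈ L^p(G)` for `p · min(λ, 2-λ) > 2`,
and Harish-Chandra's `Ξ = φ_1 ∈ L^{2+ε}(G)`

From the asymptotics `e^{(2-λ)t} sph λ (a_t) → c(2 - λ)` (`T5SU11SphericalAsymptotic`, `1 < λ < 2`) and
the continuity of `t ↦ sph λ (a_t)`, the rescaled function `e^{(2-λ)t} sph λ (a_t)` is bounded on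
`[0, ∞)` (`exists_bound_exp_mul_sph_hyp`), hence **`sph λ g ≤ C · |a(g)|^{-(2-λ)}`** on the whole group
(`exists_sph_le_norm_mat_inv_rpow`: `e^{-st} ≤ cosh(t)^{-s}` and `cosh (cartanT g) = |a(g)|`). Since
`|a(g)|^{-s} ∈ L¹(SU(1,1))` exactly for `s > 2` (`T5BergmanIntegrableSharp.integrable_norm_mat_inv_rpow`),
**`sph λ ^ p` is integrable against every Haar measure as soon as `p (2 - λ) > 2`** (`integrable_sph_rpow`,
`1 < λ < 2`); by the functional equation the same holds for `0 < λ < 1` when `p λ > 2`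
(`integrable_sph_rpow_of_lt_one`), and altogether for `0 < λ < 2` when `p λ > 2` and `p (2 - λ) > 2`
(`integrable_sph_rpow_of_mem_Ioo`, `memLp_sph`). At the centre `λ = 1` the comparison
`sph 1 ≤ sph λ'` (`T5SU11SphericalBounds.sph_one_le`) with `λ' ∈ (1, 2 - 2/p)` gives
**Harish-Chandra's `Ξ = φ_1 ∈ L^p(SU(1,1))` for every `p > 2`** (`integrable_sph_one_rpow`, `memLp_sph_one`)
— the `Ξ ∈ L^{2+ε}` statement of the Kunze–Stein / Harish-Chandra theory, here without the logarithmic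
estimate of `Ξ`. Nothing is claimed about (N).

Blind lane: Mathlib + the HodgeRepro2 prefix only; no sorry; axioms ⊆ {propext, Classical.choice,
Quot.sound}.
-/

namespace Summit.Ventures.HodgeRepro2.T5SU11SphericalLp

open MeasureTheory MeasureTheory.Measure Metric Set Filter Topology Complex
open T5SU11Unimodular T5SU11Fibration T5SU11Cartan T5SU11OneParameter T5SU11CartanProjection
  T5HaarCircle T5BergmanCoefficient T5SU11SphericalFunction T5SU11SphericalTwo
  T5SU11SphericalSymmetry T5SU11SphericalBounds T5SU11SphericalContinuous
  T5SU11SphericalAsymptotic T5BergmanIntegrableSharp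
open scoped Real ENNReal

/-! ### `e^{-st} ≤ cosh(t)^{-s}` -/

/-- `cosh t ≤ e^t` for `t ≥ 0`. -/
lemma cosh_le_exp_of_nonneg {t : ℝ} (ht : 0 ≤ t) : Real.cosh t ≤ Real.exp t := by
  rw [Real.cosh_eq]
  have : Real.exp (-t) ≤ Real.exp t := Real.exp_le_exp.mpr (by linarith)
  linarith

/-- `e^{-st} ≤ cosh(t)^{-s}` for `s ≥ 0`, `t ≥ 0`. -/
lemma exp_neg_mul_le_cosh_rpow_neg {s t : ℝ} (hs : 0 ≤ s) (ht : 0 ≤ t) :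
    Real.exp (-(s * t)) ≤ Real.cosh t ^ (-s) := by
  rw [show -(s * t) = t * (-s) by ring, Real.exp_mul]
  exact Real.rpow_le_rpow_of_nonpos (Real.cosh_pos t) (cosh_le_exp_of_nonneg ht) (by linarith)

section measure

variable [MeasurableSpace Circle] [BorelSpace Circle]

/-! ### The global bound `sph λ g ≤ C |a(g)|^{-(2-λ)}` for `1 < λ < 2` -/

/-- **`e^{(2-λ)t} sph λ (a_t)` is bounded on `[0, ∞)`** for `λ > 1`: eventually bounded by the limit
`c(2 - λ) + 1`, and continuous on the compact initial segment. -/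
theorem exists_bound_exp_mul_sph_hyp {lam : ℝ} (hlam : 1 < lam) :
    ∃ C : ℝ, ∀ t : ℝ, 0 ≤ t → Real.exp ((2 - lam) * t) * sph lam (hyp t) ≤ C := by
  have h := tendsto_exp_two_sub_mul_sph_hyp hlam
  obtain ⟨T, hT⟩ := Filter.eventually_atTop.mp (h.eventually_le_const (lt_add_one _))
  have hc : ContinuousOn (fun t : ℝ => Real.exp ((2 - lam) * t) * sph lam (hyp t)) (Icc 0 T) :=
    (Continuous.mul (by fun_prop) (continuous_sph_hyp lam)).continuousOn
  obtain ⟨C₀, hC₀⟩ := isCompact_Icc.exists_bound_of_continuousOn hc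
  refine ⟨max C₀ (cfun (2 - lam) + 1), fun t ht => ?_⟩
  rcases le_or_gt t T with htT | htT
  · exact le_trans (le_trans (le_abs_self _) (hC₀ t ⟨ht, htT⟩)) (le_max_left _ _)
  · exact le_trans (hT t htT.le) (le_max_right _ _)

/-- **`sph λ g ≤ C · |a(g)|^{-(2-λ)}` on the whole group** for `1 < λ < 2` (with `C ≥ 0`). -/
theorem exists_sph_le_norm_mat_inv_rpow {lam : ℝ} (hlam : 1 < lam) (hlam2 : lam < 2) :
    ∃ C : ℝ, 0 ≤ C ∧ ∀ g : SU11, sph lam g ≤ C * ‖mat g 0 0‖⁻¹ ^ (2 - lam) := by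
  obtain ⟨C, hC⟩ := exists_bound_exp_mul_sph_hyp hlam
  refine ⟨max C 0, le_max_right _ _, fun g => ?_⟩
  have ht := cartanT_nonneg g
  have h1 := hC (cartanT g) ht
  rw [sph_eq_sph_hyp_cartanT]
  have hpos : 0 < Real.exp ((2 - lam) * cartanT g) := Real.exp_pos _
  have h2 : sph lam (hyp (cartanT g)) ≤ C * Real.exp (-((2 - lam) * cartanT g)) := by
    rw [Real.exp_neg, ← div_eq_mul_inv, le_div_iff₀ hpos, mul_comm]
    exact h1
  calc sph lam (hyp (cartanT g)) ≤ C * Real.exp (-((2 - lam) * cartanT g)) := h2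
    _ ≤ max C 0 * Real.exp (-((2 - lam) * cartanT g)) :=
        mul_le_mul_of_nonneg_right (le_max_left _ _) (Real.exp_pos _).le
    _ ≤ max C 0 * Real.cosh (cartanT g) ^ (-(2 - lam)) :=
        mul_le_mul_of_nonneg_left (exp_neg_mul_le_cosh_rpow_neg (by linarith) ht) (le_max_right _ _)
    _ = max C 0 * ‖mat g 0 0‖⁻¹ ^ (2 - lam) := by
        rw [cosh_cartanT, Real.rpow_neg (norm_nonneg _), ← Real.inv_rpow (norm_nonneg _)]

/-! ### `L^p`-integrability -/

/-- **`sph λ ^ p ∈ L¹(SU(1,1), μ)` for `1 < λ < 2` and `p (2 - λ) > 2`**, against every Haar measure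
`μ`: comparison with `C^p |a(g)|^{-p(2-λ)}`. -/
theorem integrable_sph_rpow (μ : Measure SU11) [IsHaarMeasure μ] {lam p : ℝ} (hlam : 1 < lam)
    (hlam2 : lam < 2) (hp : 2 < p * (2 - lam)) : Integrable (fun g => sph lam g ^ p) μ := by
  obtain ⟨C, hC0, hC⟩ := exists_sph_le_norm_mat_inv_rpow hlam hlam2
  have hp0 : 0 < p := by
    by_contra h
    have : p * (2 - lam) ≤ 0 := mul_nonpos_of_nonpos_of_nonneg (not_lt.mp h) (by linarith)
    linarith
  have hbound : Integrable (fun g => C ^ p * ‖mat g 0 0‖⁻¹ ^ (p * (2 - lam))) μ :=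
    (integrable_norm_mat_inv_rpow μ hp).const_mul _
  refine hbound.mono' ((continuous_sph lam).rpow_const fun g => Or.inr hp0.le).aestronglyMeasurable
    (Filter.Eventually.of_forall fun g => ?_)
  rw [Real.norm_eq_abs, abs_of_nonneg (Real.rpow_nonneg (sph_pos lam g).le _)]
  have hinv : 0 ≤ ‖mat g 0 0‖⁻¹ := inv_nonneg.mpr (norm_nonneg _)
  calc sph lam g ^ p ≤ (C * ‖mat g 0 0‖⁻¹ ^ (2 - lam)) ^ p :=
        Real.rpow_le_rpow (sph_pos lam g).le (hC g) hp0.le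
    _ = C ^ p * ‖mat g 0 0‖⁻¹ ^ (p * (2 - lam)) := by
        rw [Real.mul_rpow hC0 (Real.rpow_nonneg hinv _), ← Real.rpow_mul hinv, mul_comm (2 - lam) p]

/-- **`sph λ ^ p ∈ L¹(SU(1,1), μ)` for `0 < λ < 1` and `p λ > 2`** (the functional equation
`sph λ = sph (2 - λ)`). -/
theorem integrable_sph_rpow_of_lt_one (μ : Measure SU11) [IsHaarMeasure μ] {lam p : ℝ}
    (h0 : 0 < lam) (h1 : lam < 1) (hp : 2 < p * lam) : Integrable (fun g => sph lam g ^ p) μ := by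
  have := integrable_sph_rpow μ (lam := 2 - lam) (by linarith) (by linarith)
    (by rw [show 2 - (2 - lam) = lam by ring]; exact hp)
  simpa only [← sph_two_sub lam] using this

/-- **Harish-Chandra's `Ξ = sph 1` is in `L^p(SU(1,1), μ)` for every `p > 2`**: `sph 1 ≤ sph λ'` for
`λ' = (3 - 2/p)/2 ∈ (1, 2)`, and `p (2 - λ') = p/2 + 1 > 2`. -/
theorem integrable_sph_one_rpow (μ : Measure SU11) [IsHaarMeasure μ] {p : ℝ} (hp : 2 < p) :
    Integrable (fun g => sph 1 g ^ p) μ := by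
  have hp0 : 0 < p := by linarith
  have h2p : 2 / p < 1 := by
    rw [div_lt_one hp0]
    exact hp
  have h2p' : 0 < 2 / p := by positivity
  have hl1 : 1 < (3 - 2 / p) / 2 := by linarith
  have hl2 : (3 - 2 / p) / 2 < 2 := by linarith
  have hpl : 2 < p * (2 - (3 - 2 / p) / 2) := by
    have : p * (2 - (3 - 2 / p) / 2) = p / 2 + 1 := by
      field_simp
      ring
    rw [this]
    linarith
  have hint := integrable_sph_rpow μ hl1 hl2 hpl
  refine hint.mono' ((continuous_sph 1).rpow_const fun g => Or.inr hp0.le).aestronglyMeasurable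
    (Filter.Eventually.of_forall fun g => ?_)
  rw [Real.norm_eq_abs, abs_of_nonneg (Real.rpow_nonneg (sph_pos 1 g).le _)]
  exact Real.rpow_le_rpow (sph_pos 1 g).le (sph_one_le _ g) hp0.le

/-- **`sph λ ^ p ∈ L¹(SU(1,1), μ)` for `0 < λ < 2` whenever `p λ > 2` and `p (2 - λ) > 2`** — the three
cases `λ < 1`, `λ = 1`, `λ > 1`. -/
theorem integrable_sph_rpow_of_mem_Ioo (μ : Measure SU11) [IsHaarMeasure μ] {lam p : ℝ}
    (h0 : 0 < lam) (h2 : lam < 2) (hp1 : 2 < p * lam) (hp2 : 2 < p * (2 - lam)) :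
    Integrable (fun g => sph lam g ^ p) μ := by
  rcases lt_trichotomy lam 1 with h | h | h
  · exact integrable_sph_rpow_of_lt_one μ h0 h hp1
  · subst h
    exact integrable_sph_one_rpow μ (by linarith)
  · exact integrable_sph_rpow μ h h2 hp2

/-- **`sph λ ∈ L^p(SU(1,1), μ)`** (Mathlib's `MemLp`) for `0 < λ < 2`, `p λ > 2` and `p (2 - λ) > 2`. -/
theorem memLp_sph (μ : Measure SU11) [IsHaarMeasure μ] {lam p : ℝ} (h0 : 0 < lam) (h2 : lam < 2)
    (hp1 : 2 < p * lam) (hp2 : 2 < p * (2 - lam)) : MemLp (sph lam) (ENNReal.ofReal p) μ := by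
  have hp0 : 0 < p := by
    by_contra h
    have : p * lam ≤ 0 := mul_nonpos_of_nonpos_of_nonneg (not_lt.mp h) h0.le
    linarith
  rw [← integrable_norm_rpow_iff (continuous_sph lam).aestronglyMeasurable
    (by simp [hp0]) ENNReal.ofReal_ne_top, ENNReal.toReal_ofReal hp0.le]
  have e : (fun g : SU11 => ‖sph lam g‖ ^ p) = fun g => sph lam g ^ p := by
    funext g
    rw [Real.norm_eq_abs, abs_of_nonneg (sph_pos lam g).le]
  rw [e]
  exact integrable_sph_rpow_of_mem_Ioo μ h0 h2 hp1 hp2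

/-- **Harish-Chandra's `Ξ = sph 1 ∈ L^{2+ε}(SU(1,1))`**: `MemLp (sph 1) p μ` for every real `p > 2` and
every Haar measure `μ`. -/
theorem memLp_sph_one (μ : Measure SU11) [IsHaarMeasure μ] {p : ℝ} (hp : 2 < p) :
    MemLp (sph 1) (ENNReal.ofReal p) μ :=
  memLp_sph μ zero_lt_one one_lt_two (by linarith) (by linarith)

end measure

end Summit.Ventures.HodgeRepro2.T5SU11SphericalLp
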